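/-
Origin: expansion seat `planner-pub-hodgecm-pv02-g3-0`, handover #4 2026-08-18T05:18:37Z (`HOME/pub-hodgecm-pv02-g3/lean/Pv02g3/PerL34/BallCRExp.lean`, md5 9c10c91c, 140 lines);
landed by the gen-6 packager in gate run 22 as `HodgeCM/PerL34/BallCRExp.lean` (import ^import Pv[0-9]+g[0-9]+\.PerL34\.→import HodgeCM.PerL34. ×1; stripped 3 #print/#check/#eval lines).
-/
/-
Origin: planner-pub-hodgecm-pv02-g3-0 (unit pub-hodgecm-pv02-g3, DAG-NODE PROVER #02 gen 3), 2026-08-18.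
Proposed tree path: `HodgeCM/PerL34/BallCRExp.lean` (new, additive; lands AFTER `BallCRCurves` (pv02-g3)).
PACKAGER: `import Pv02g3.PerL34.BallCRCurves` becomes `import HodgeCM.PerL34.BallCRCurves`; the two `Mathlib`
imports are new to the package (matrix exponential).  KERNEL: nothing cited, nothing asserted.
-/
import Mathlib.Analysis.Normed.Algebra.MatrixExponential
import Mathlib.Analysis.SpecialFunctions.Exponential
import Summits.HodgeConjecture.HodgeCM.PerL34.BallCRCurves

/-!
# The one-parameter subgroups `exp(t X)` of `U(2,1)` and the `𝔭₋`-operators as honest Lie derivatives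

For `X ∈ 𝔲(2,1) = {X | Xᴴ J + J X = 0}` the matrix exponential `exp X` lies in `U(2,1)` (`exp_preserves_J`,
`expU`), `t ↦ exp(tX)` is a curve through `1` whose entries have derivative `X` at `t = 0`
(`hasDerivAt_mat_expCurve`), hence for `X = X_v ∈ 𝔭` a `BallCR.TangentCurve` (`tangentCurve_exp`).  Consequently
(`Xminus_eq_lieDeriv`) on cochains

  `X⁻_v φ (g) = d/dt φ(g·exp(t X_v))|₀ + i · d/dt φ(g·exp(t X_{iv}))|₀`,

i.e. `BallCR.Xminus v` restricted to `ballFD.Cochain` is LITERALLY the right Lie derivative `R(X_v + i X_{iv})`,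
`X_v + iX_{iv} ∈ 𝔭^{0,1} = 𝔭₋` — the textbook operator of [BW] II 4.2 (6) / VII 2.5, with no parametrisation
artefact left.  (The (X1) side, "`R(𝔭₋)` kills the theta one-forms", is a statement about exactly these
derivatives.)
-/

noncomputable section

open Complex ComplexConjugate NormedSpace
open scoped Matrix

namespace HodgeCM
namespace PerL34
namespace BallCR

open HodgeCM.PerL34.BallModel HodgeCM.PerL34.BallSpans HodgeCM.PerL34.BallFrame

/-- `3 × 3` complex matrices. -/
abbrev M3 : Type := Matrix (Fin 3) (Fin 3) ℂ

/-- (Ported verbatim from the HodgeCMPerL package; no docstring in the source.) -/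
theorem J_mul_J : J * J = (1 : M3) := by
  ext i j; fin_cases i <;> fin_cases j <;> simp [J, Matrix.mul_apply, Matrix.diagonal_apply]

/-- `J` as a unit of the matrix ring. -/
def Ju : M3ˣ := ⟨J, J, J_mul_J, J_mul_J⟩

/-- (Ported verbatim from the HodgeCMPerL package; no docstring in the source.) -/
@[simp] theorem Ju_val : ((Ju : M3ˣ) : M3) = J := rfl
/-- (Ported verbatim from the HodgeCMPerL package; no docstring in the source.) -/
@[simp] theorem Ju_inv_val : ((Ju⁻¹ : M3ˣ) : M3) = J := rfl

/-- **`exp` maps `𝔲(2,1)` into `U(2,1)`**: if `Xᴴ J + J X = 0` then `(exp X)ᴴ J (exp X) = J`.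
(`Xᴴ = J(−X)J⁻¹`, so `(exp X)ᴴ = exp(Xᴴ) = J exp(−X) J`, and `exp(−X) exp X = exp 0 = 1`.) -/
theorem exp_preserves_J (X : M3) (hX : Xᴴ * J + J * X = 0) : (exp X)ᴴ * J * exp X = J := by
  have h1 : Xᴴ * J = -(J * X) := eq_neg_of_add_eq_zero_left hX
  have hXH : Xᴴ = ((Ju : M3ˣ) : M3) * (-X) * ((Ju⁻¹ : M3ˣ) : M3) := by
    have h2 : Xᴴ = Xᴴ * J * J := by rw [Matrix.mul_assoc, J_mul_J, Matrix.mul_one]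
    rw [h2, h1, Ju_val, Ju_inv_val, Matrix.mul_neg, Matrix.neg_mul]
  have hexpH : (exp X)ᴴ = J * exp (-X) * J := by
    rw [← Matrix.exp_conjTranspose, hXH, Matrix.exp_units_conj, Ju_val, Ju_inv_val]
  rw [hexpH, Matrix.mul_assoc (J * exp (-X)) J J, J_mul_J, Matrix.mul_one, Matrix.mul_assoc,
    ← Matrix.exp_add_of_commute _ _ ((Commute.refl X).neg_left), neg_add_cancel, NormedSpace.exp_zero, Matrix.mul_one]

/-- `exp X ∈ U(2,1)` for `X ∈ 𝔲(2,1)`. -/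
def expU (X : M3) (hX : Xᴴ * J + J * X = 0) : U21 := mkU21 (exp X) (exp_preserves_J X hX)

/-- (Ported verbatim from the HodgeCMPerL package; no docstring in the source.) -/
@[simp] theorem mat_expU (X : M3) (hX : Xᴴ * J + J * X = 0) : mat (expU X hX) = exp X := rfl

/-- Real multiples of an element of `𝔲(2,1)` stay in `𝔲(2,1)`. -/
theorem real_smul_mem (X : M3) (hX : Xᴴ * J + J * X = 0) (t : ℝ) :
    ((t : ℂ) • X)ᴴ * J + J * ((t : ℂ) • X) = 0 := by
  rw [Matrix.conjTranspose_smul, Complex.star_def, Complex.conj_ofReal, Matrix.smul_mul, Matrix.mul_smul,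
    ← smul_add, hX, smul_zero]

/-- **The one-parameter subgroup** `t ↦ exp(t X)` of `U(2,1)` generated by `X ∈ 𝔲(2,1)`. -/
def expCurve (X : M3) (hX : Xᴴ * J + J * X = 0) (t : ℝ) : U21 := expU ((t : ℂ) • X) (real_smul_mem X hX t)

/-- (Ported verbatim from the HodgeCMPerL package; no docstring in the source.) -/
@[simp] theorem mat_expCurve (X : M3) (hX : Xᴴ * J + J * X = 0) (t : ℝ) :
    mat (expCurve X hX t) = exp ((t : ℂ) • X) := rfl

/-- (Ported verbatim from the HodgeCMPerL package; no docstring in the source.) -/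
theorem expCurve_zero (X : M3) (hX : Xᴴ * J + J * X = 0) : expCurve X hX 0 = 1 := by
  apply Subtype.ext; apply Units.ext
  change exp (((0 : ℝ) : ℂ) • X) = ((1 : U21) : GL3).1
  simp

/-- It is a homomorphism `ℝ → U(2,1)`: `exp((s+t)X) = exp(sX) exp(tX)`. -/
theorem expCurve_add (X : M3) (hX : Xᴴ * J + J * X = 0) (s t : ℝ) :
    expCurve X hX (s + t) = expCurve X hX s * expCurve X hX t := by
  apply Subtype.ext; apply Units.ext
  change exp (((s + t : ℝ) : ℂ) • X) = exp ((s : ℂ) • X) * exp ((t : ℂ) • X)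
  rw [Complex.ofReal_add, add_smul]
  exact Matrix.exp_add_of_commute _ _ ((Commute.refl X).smul_left _ |>.smul_right _)

section deriv

attribute [local instance] Matrix.linftyOpNormedRing Matrix.linftyOpNormedAlgebra

/-- Entrywise derivative of `u ↦ exp(uX)` at `u = 0` (complex parameter). -/
theorem hasDerivAt_exp_smul_entry (X : M3) (i j : Fin 3) :
    HasDerivAt (fun u : ℂ => exp (u • X) i j) (X i j) 0 := by
  have h : HasDerivAt (fun u : ℂ => exp (u • X)) (exp ((0 : ℂ) • X) * X) 0 := hasDerivAt_exp_smul_const X 0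
  rw [zero_smul, NormedSpace.exp_zero, one_mul] at h
  let L : M3 →L[ℂ] ℂ := LinearMap.toContinuousLinearMap (Matrix.entryLinearMap ℂ ℂ i j)
  exact L.hasFDerivAt.comp_hasDerivAt (0 : ℂ) h

end deriv

/-- **`d/dt exp(tX)_{ij} |₀ = X_{ij}`** (real parameter). -/
theorem hasDerivAt_mat_expCurve (X : M3) (hX : Xᴴ * J + J * X = 0) (i j : Fin 3) :
    HasDerivAt (fun t : ℝ => mat (expCurve X hX t) i j) (X i j) 0 := by
  have h := hasDerivAt_exp_smul_entry X i j
  have h' : HasDerivAt (fun u : ℂ => exp (u • X) i j) (X i j) ((0 : ℝ) : ℂ) := by rwa [Complex.ofReal_zero]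
  exact h'.comp_ofReal

/-- **`t ↦ exp(t X_v)` is a tangent curve for `X_v ∈ 𝔭`.** -/
theorem tangentCurve_exp (v : Fin 2 → ℂ) : TangentCurve v (expCurve (Xp v) (Xp_mem v)) :=
  ⟨expCurve_zero _ _, hasDerivAt_mat_expCurve _ _⟩

/-- **`X⁻_v` on cochains is the right Lie derivative `R(X_v + i X_{iv})`**:
`X⁻_v φ (g) = d/dt φ(g·exp(tX_v))|₀ + i · d/dt φ(g·exp(tX_{iv}))|₀`. -/
theorem Xminus_eq_lieDeriv {φ : U21 → (Fin 2 → ℂ)} (hφ : φ ∈ ballFD.Cochain) (v : Fin 2 → ℂ) (g : U21) :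
    Xminus v φ g = deriv (fun t : ℝ => φ (g * expCurve (Xp v) (Xp_mem v) t)) 0 +
      I • deriv (fun t : ℝ => φ (g * expCurve (Xp (I • v)) (Xp_mem (I • v)) t)) 0 :=
  Xminus_apply_of_curves hφ (tangentCurve_exp v) (tangentCurve_exp (I • v)) g

/-- The (X1)-type clause checked on the one-parameter subgroups: if `R(X_v + iX_{iv}) φ = 0` for all `v`
(derivatives along `exp`), then every `X ∈ ballFD.Pminus` kills the cochain `φ`. -/
theorem killed_of_lieDeriv {φ : U21 → (Fin 2 → ℂ)} (hφ : φ ∈ ballFD.Cochain)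
    (h0 : ∀ v g, deriv (fun t : ℝ => φ (g * expCurve (Xp v) (Xp_mem v) t)) 0 +
      I • deriv (fun t : ℝ => φ (g * expCurve (Xp (I • v)) (Xp_mem (I • v)) t)) 0 = 0) :
    ∀ X ∈ ballFD.Pminus, X φ = 0 :=
  killed_of_curves hφ (fun v => expCurve (Xp v) (Xp_mem v)) tangentCurve_exp h0

end BallCR
end PerL34
end HodgeCM

end

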